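import Mathlib
import Literature.NumberTheory.Sieve.Maynard2016Lemma7ErrorSplit
import Literature.NumberTheory.Sieve.Maynard2016Lemma7Regroup
import Literature.NumberTheory.Sieve.Maynard2016Lemma7BV
import Literature.NumberTheory.Sieve.Maynard2016LamModulus
import Literature.NumberTheory.Sieve.Maynard2016LamBound
import HarnessLib

/-!
# Maynard (2016), Lemma 7: the error terms are `≪ x (log x)^{−A}` ((6.29)–(6.31))

Topic `Literature/NumberTheory/Sieve`; trunk AntSieve / parity (Maynard 2016 large-gaps ladder, named
fact `Literature.NumberTheory.Sieve.Maynard2016.Lemma7Tuple` of `Maynard2016Lemma7PerTuple.lean`).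

J. Maynard, *Large gaps between primes*, Ann. of Math. (2) 183 (2016), 915–933 = arXiv:1408.5110,
§6, proof of Lemma 7, p. 12: "`r = r_{d,d',e,e'} < x^{1/5+o(1)}` (from the support conditions) … the
error terms contribute a total `≪ y^k λ_max² (log x)^{2k} Σ_{r < x^{1/5+o(1)}} τ_{O(k)}(r) E(x; r)
≪ λ_max² x/(log x)^{4k}`. Here we used the Bombieri–Vinogradov Theorem" ((6.29)–(6.31)).

PROVED here (no named facts; Bombieri–Vinogradov enters through the tree's PROVED
`BombieriVinogradovStatement_holds`, via `Maynard2016Lemma7BV`):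
* `primeFactors_prod_sysD`, `radMod_eq_rad_prod` — the modulus `r` is the radical of
  `∏_j d_j d'_j e_j e'_j`;
* `errorSum_le_of_abs_lam_le` — regrouping by `r` (`Maynard2016Lemma7Regroup`):
  `Σ_{d,d',e,e' ∈ rbox} |λλ'| 2E*(X; r) ≤ Λ² Σ_{r ≤ x^{1/5} y^{2k}, μ²(r)=1} (2^{4k})^{ω(r)} 2E*(X; r)`
  for any bound `|λ| ≤ Λ` (the moduli on the support of `λλ'` being squarefree with product
  `≤ x^{1/5} y^{2k}`, `Maynard2016LamModulus`);
* `eventually_rpow_mul_y_pow_le` — `x^{1/5} y^{2k} ≤ x^{1/4}` for all large `x` (`0 ≤ ε`);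
* `exists_eventually_errorSum_le` — **for every `A > 0` there is `C` with, for all large `x` and
  every `i`, `Σ_{d,d',e,e' ∈ rbox} |λλ'| 2E*(x; r) ≤ C x/(log x)^A`** (`0 ≤ ε ≤ 1/2`).

Combined with `abs_sum_divSum_sq_sub_main_le` (`Maynard2016Lemma7ErrorSplit`, with `X = x ≥ B`) this
is the error-term half of the per-tuple estimate `Lemma7Tuple`; the main-term half ((6.32)) remains.

## References

* J. Maynard, *Large gaps between primes*, Ann. of Math. (2) 183 (2016), 915–933; arXiv:1408.5110,
  §6, proof of Lemma 7, displays (6.29)–(6.31). [Maynard2016LargeGaps]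
-/

noncomputable section

open Finset Filter
open scoped BigOperators ArithmeticFunction.omega

namespace Literature.NumberTheory.Sieve

namespace Maynard2016

variable {k : ℕ}

/-! ### `r` is the radical of `∏_j d_j d'_j e_j e'_j` -/

/-- A prime divides `[a, b]` iff it divides `a` or `b`. [folklore] -/
private theorem prime_dvd_lcm_iff {p a b : ℕ} (hp : p.Prime) : p ∣ Nat.lcm a b ↔ p ∣ a ∨ p ∣ b :=
  ⟨fun h => hp.dvd_mul.1 (h.trans (Nat.lcm_dvd_mul a b)), fun h =>
    h.elim (fun h => h.trans (Nat.dvd_lcm_left a b)) fun h => h.trans (Nat.dvd_lcm_right a b)⟩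

/-- The prime factors of `∏_j [d_j,d'_j] [e_j,e'_j]` are those of `∏_j d_j · ∏_j d'_j · ∏_j e_j · ∏_j e'_j`
(non-zero coordinates). [cite: Maynard2016LargeGaps, Lemma 7 (proof, display (6.28))] -/
theorem primeFactors_prod_sysD {d d' e e' : Fin k → ℕ} (hd0 : ∀ j, d j ≠ 0) (hd0' : ∀ j, d' j ≠ 0)
    (he0 : ∀ j, e j ≠ 0) (he0' : ∀ j, e' j ≠ 0) :
    (∏ t, sysD d d' e e' t).primeFactors =
      ((∏ j, d j) * (∏ j, d' j) * ((∏ j, e j) * ∏ j, e' j)).primeFactors := by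
  have hN1 : (∏ t, sysD d d' e e' t) ≠ 0 := by
    rw [prod_sysD]
    exact Nat.mul_ne_zero (Finset.prod_ne_zero_iff.2 fun j _ => Nat.lcm_ne_zero (hd0 j) (hd0' j))
      (Finset.prod_ne_zero_iff.2 fun j _ => Nat.lcm_ne_zero (he0 j) (he0' j))
  have hN2 : (∏ j, d j) * (∏ j, d' j) * ((∏ j, e j) * ∏ j, e' j) ≠ 0 :=
    Nat.mul_ne_zero (Nat.mul_ne_zero (Finset.prod_ne_zero_iff.2 fun j _ => hd0 j)
      (Finset.prod_ne_zero_iff.2 fun j _ => hd0' j))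
      (Nat.mul_ne_zero (Finset.prod_ne_zero_iff.2 fun j _ => he0 j)
        (Finset.prod_ne_zero_iff.2 fun j _ => he0' j))
  ext p
  simp only [Nat.mem_primeFactors]
  constructor
  · rintro ⟨hp, hdvd, -⟩
    refine ⟨hp, ?_, hN2⟩
    rw [prod_sysD] at hdvd
    rcases hp.dvd_mul.1 hdvd with h | h
    · obtain ⟨j, -, hj⟩ := (hp.prime.dvd_finsetProd_iff _).1 h
      change p ∣ Nat.lcm (d j) (d' j) at hj
      rcases (prime_dvd_lcm_iff hp).1 hj with h1 | h1
      · exact dvd_mul_of_dvd_left (dvd_mul_of_dvd_left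
          (h1.trans (Finset.dvd_prod_of_mem (fun j => d j) (Finset.mem_univ j))) _) _
      · exact dvd_mul_of_dvd_left (dvd_mul_of_dvd_right
          (h1.trans (Finset.dvd_prod_of_mem (fun j => d' j) (Finset.mem_univ j))) _) _
    · obtain ⟨j, -, hj⟩ := (hp.prime.dvd_finsetProd_iff _).1 h
      change p ∣ Nat.lcm (e j) (e' j) at hj
      rcases (prime_dvd_lcm_iff hp).1 hj with h1 | h1
      · exact dvd_mul_of_dvd_right (dvd_mul_of_dvd_left
          (h1.trans (Finset.dvd_prod_of_mem (fun j => e j) (Finset.mem_univ j))) _) _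
      · exact dvd_mul_of_dvd_right (dvd_mul_of_dvd_right
          (h1.trans (Finset.dvd_prod_of_mem (fun j => e' j) (Finset.mem_univ j))) _) _
  · rintro ⟨hp, hdvd, -⟩
    refine ⟨hp, ?_, hN1⟩
    rw [prod_sysD]
    rcases hp.dvd_mul.1 hdvd with h | h <;> rcases hp.dvd_mul.1 h with h1 | h1
    · obtain ⟨j, -, hj⟩ := (hp.prime.dvd_finsetProd_iff _).1 h1
      refine dvd_mul_of_dvd_left ((hj.trans (Nat.dvd_lcm_left (d j) (d' j))).trans ?_) _
      exact Finset.dvd_prod_of_mem (fun j => sysD d d' e e' (Sum.inl j)) (Finset.mem_univ j)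
    · obtain ⟨j, -, hj⟩ := (hp.prime.dvd_finsetProd_iff _).1 h1
      refine dvd_mul_of_dvd_left ((hj.trans (Nat.dvd_lcm_right (d j) (d' j))).trans ?_) _
      exact Finset.dvd_prod_of_mem (fun j => sysD d d' e e' (Sum.inl j)) (Finset.mem_univ j)
    · obtain ⟨j, -, hj⟩ := (hp.prime.dvd_finsetProd_iff _).1 h1
      refine dvd_mul_of_dvd_right ((hj.trans (Nat.dvd_lcm_left (e j) (e' j))).trans ?_) _
      exact Finset.dvd_prod_of_mem (fun j => sysD d d' e e' (Sum.inr j)) (Finset.mem_univ j)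
    · obtain ⟨j, -, hj⟩ := (hp.prime.dvd_finsetProd_iff _).1 h1
      refine dvd_mul_of_dvd_right ((hj.trans (Nat.dvd_lcm_right (e j) (e' j))).trans ?_) _
      exact Finset.dvd_prod_of_mem (fun j => sysD d d' e e' (Sum.inr j)) (Finset.mem_univ j)

/-- `r_{d,d',e,e'} = rad(∏_j d_j · ∏_j d'_j · ∏_j e_j · ∏_j e'_j)` (non-zero coordinates). [cite: Maynard2016LargeGaps, Lemma 7 (proof, display (6.28))] -/
theorem radMod_eq_rad_prod {d d' e e' : Fin k → ℕ} (hd0 : ∀ j, d j ≠ 0) (hd0' : ∀ j, d' j ≠ 0)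
    (he0 : ∀ j, e j ≠ 0) (he0' : ∀ j, e' j ≠ 0) :
    radMod d d' e e' =
      ∏ p ∈ ((∏ j, d j) * (∏ j, d' j) * ((∏ j, e j) * ∏ j, e' j)).primeFactors, p := by
  rw [radMod, primeFactors_prod_sysD hd0 hd0' he0 he0']

/-! ### Regrouping the error sum by the modulus `r` -/

/-- Coordinates of a box element are `≥ 1`. [folklore] -/
private theorem one_le_of_mem_box' {X : ℕ} {d : Fin k → ℕ} (hd : d ∈ box k X) (ℓ : Fin k) :
    1 ≤ d ℓ :=
  (Finset.mem_Icc.1 (Fintype.mem_piFinset.1 hd ℓ)).1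

/-- **The error sum regrouped by `r` ((6.29)–(6.30)).**  For any bound `|λ_{d,e}| ≤ Λ`:
`Σ_{d,d',e,e' ∈ rbox} |λ_{d,e} λ_{d',e'}| · 2E*(X; r_{d,d',e,e'})
 ≤ Λ² Σ_{r ≤ x^{1/5} y^{2k}, r squarefree} (2^{4k})^{ω(r)} · 2E*(X; r)`. [cite: Maynard2016LargeGaps, Lemma 7 (proof, displays (6.29)–(6.30))] -/
theorem errorSum_le_of_abs_lam_le {J : ℕ} {c : Fin J → ℝ} {Fd : Fin k → Fin J → ℝ → ℝ}
    {G : ℝ → ℝ} (hD : IsSieveData k J c Fd G) {ε : ℝ} {x : ℕ} (hlogx : 0 < Real.log x)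
    (hlogy : 0 < Real.log (y ε x)) (i : Fin k) (X : ℕ) {Λ : ℝ} (hΛ0 : 0 ≤ Λ)
    (hΛ : ∀ d e : Fin k → ℕ, |lam c Fd G ε x d e| ≤ Λ) :
    ∑ d ∈ rbox k x i, ∑ d' ∈ rbox k x i, ∑ e ∈ rbox k x i, ∑ e' ∈ rbox k x i,
        |lam c Fd G ε x d e * lam c Fd G ε x d' e'| *
          (2 * primeCountingAPErrMax X (radMod d d' e e')) ≤
      Λ ^ 2 * ∑ r ∈ (Finset.Icc 1 ⌊(x : ℝ) ^ (1 / 5 : ℝ) * y ε x ^ (2 * k)⌋₊).filter Squarefree,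
        ((2 : ℝ) ^ (4 * k)) ^ ω r * (2 * primeCountingAPErrMax X r) := by
  classical
  have hx1 : (1 : ℝ) < x := by
    by_contra h
    push Not at h
    exact absurd (Real.log_nonpos (Nat.cast_nonneg _) h) (not_le.2 hlogx)
  have hx0 : (0 : ℝ) < x := by linarith
  have hy0 : 0 ≤ y ε x := (Real.exp_pos _).le
  -- the nested sum as a sum over the product finset
  set T := rbox k x i ×ˢ (rbox k x i ×ˢ (rbox k x i ×ˢ rbox k x i)) with hT
  set F : (Fin k → ℕ) × (Fin k → ℕ) × (Fin k → ℕ) × (Fin k → ℕ) → ℝ := fun a =>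
    |lam c Fd G ε x a.1 a.2.2.1 * lam c Fd G ε x a.2.1 a.2.2.2| *
      (2 * primeCountingAPErrMax X (radMod a.1 a.2.1 a.2.2.1 a.2.2.2)) with hF
  have h1 : ∑ d ∈ rbox k x i, ∑ d' ∈ rbox k x i, ∑ e ∈ rbox k x i, ∑ e' ∈ rbox k x i,
      |lam c Fd G ε x d e * lam c Fd G ε x d' e'| *
        (2 * primeCountingAPErrMax X (radMod d d' e e')) = ∑ a ∈ T, F a := by
    rw [hT, Finset.sum_product]
    refine Finset.sum_congr rfl fun d _ => ?_
    rw [Finset.sum_product]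
    refine Finset.sum_congr rfl fun d' _ => ?_
    rw [Finset.sum_product]
  rw [h1]
  -- restrict to the support of `λλ'`
  set S := T.filter (fun a => lam c Fd G ε x a.1 a.2.2.1 * lam c Fd G ε x a.2.1 a.2.2.2 ≠ 0)
    with hS
  have h2 : ∑ a ∈ T, F a = ∑ a ∈ S, F a := by
    rw [hS, Finset.sum_filter_of_ne]
    intro a _ hne h0
    apply hne
    simp only [hF, h0, abs_zero, zero_mul]
  rw [h2]
  have hmem : ∀ a ∈ S, (a.1 ∈ rbox k x i ∧ a.2.1 ∈ rbox k x i ∧ a.2.2.1 ∈ rbox k x i ∧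
      a.2.2.2 ∈ rbox k x i) ∧ lam c Fd G ε x a.1 a.2.2.1 ≠ 0 ∧ lam c Fd G ε x a.2.1 a.2.2.2 ≠ 0 := by
    intro a ha
    rw [hS, Finset.mem_filter, hT, Finset.mem_product, Finset.mem_product, Finset.mem_product] at ha
    exact ⟨⟨ha.1.1, ha.1.2.1, ha.1.2.2.1, ha.1.2.2.2⟩, (mul_ne_zero_iff.1 ha.2).1,
      (mul_ne_zero_iff.1 ha.2).2⟩
  -- the coordinates
  set coord : (Fin k → ℕ) × (Fin k → ℕ) × (Fin k → ℕ) × (Fin k → ℕ) →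
      ((Fin k ⊕ Fin k) ⊕ (Fin k ⊕ Fin k)) → ℕ :=
    fun a => Sum.elim (Sum.elim a.1 a.2.1) (Sum.elim a.2.2.1 a.2.2.2) with hcoord
  have hprod : ∀ a, ∏ t, coord a t =
      (∏ j, a.1 j) * (∏ j, a.2.1 j) * ((∏ j, a.2.2.1 j) * ∏ j, a.2.2.2 j) := by
    intro a
    simp only [hcoord, Fintype.prod_sum_type, Sum.elim_inl, Sum.elim_inr]
  have hne0 : ∀ a ∈ S, (∀ j, a.1 j ≠ 0) ∧ (∀ j, a.2.1 j ≠ 0) ∧ (∀ j, a.2.2.1 j ≠ 0) ∧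
      (∀ j, a.2.2.2 j ≠ 0) := by
    intro a ha
    obtain ⟨-, hl, hl'⟩ := hmem a ha
    exact ⟨fun j => (squarefree_of_lam_ne_zero hl j).1.ne_zero,
      fun j => (squarefree_of_lam_ne_zero hl' j).1.ne_zero,
      fun j => (squarefree_of_lam_ne_zero hl j).2.ne_zero,
      fun j => (squarefree_of_lam_ne_zero hl' j).2.ne_zero⟩
  have hF' : ∀ a ∈ S, F a = |lam c Fd G ε x a.1 a.2.2.1 * lam c Fd G ε x a.2.1 a.2.2.2| *
      (2 * primeCountingAPErrMax X (∏ p ∈ (∏ t, coord a t).primeFactors, p)) := by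
    intro a ha
    obtain ⟨h0, h0', h0e, h0e'⟩ := hne0 a ha
    simp only [hF]
    rw [hprod a, ← radMod_eq_rad_prod h0 h0' h0e h0e']
  rw [Finset.sum_congr rfl hF']
  -- hypotheses of the regrouping lemma
  have hsq : ∀ a ∈ S, ∀ t, Squarefree (coord a t) := by
    intro a ha
    obtain ⟨-, hl, hl'⟩ := hmem a ha
    rintro ((j | j) | (j | j))
    · simpa [hcoord] using (squarefree_of_lam_ne_zero hl j).1
    · simpa [hcoord] using (squarefree_of_lam_ne_zero hl' j).1
    · simpa [hcoord] using (squarefree_of_lam_ne_zero hl j).2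
    · simpa [hcoord] using (squarefree_of_lam_ne_zero hl' j).2
  have hM : ∀ a ∈ S, ∏ t, coord a t ≤ ⌊(x : ℝ) ^ (1 / 5 : ℝ) * y ε x ^ (2 * k)⌋₊ := by
    intro a ha
    obtain ⟨⟨hd, hd', -, -⟩, hl, hl'⟩ := hmem a ha
    have hdb := rbox_subset_box k x i hd
    have hdb' := rbox_subset_box k x i hd'
    have h1 := prod_le_rpow_tenth_of_lam_ne_zero hD hlogx (one_le_of_mem_box' hdb) hl
    have h2 := prod_le_rpow_tenth_of_lam_ne_zero hD hlogx (one_le_of_mem_box' hdb') hl'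
    have h3 := prod_le_pow_of_lam_ne_zero hD hlogy hl
    have h4 := prod_le_pow_of_lam_ne_zero hD hlogy hl'
    refine Nat.le_floor ?_
    rw [hprod a]
    push_cast
    have h15 : (x : ℝ) ^ (1 / 10 : ℝ) * (x : ℝ) ^ (1 / 10 : ℝ) = (x : ℝ) ^ (1 / 5 : ℝ) := by
      rw [← Real.rpow_add hx0]; norm_num
    have hyk : y ε x ^ k * y ε x ^ k = y ε x ^ (2 * k) := by rw [← pow_add, two_mul]
    rw [← h15, ← hyk]
    have hx10 : 0 ≤ (x : ℝ) ^ (1 / 10 : ℝ) := Real.rpow_nonneg hx0.le _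
    refine mul_le_mul (mul_le_mul h1 h2 (Finset.prod_nonneg fun j _ => Nat.cast_nonneg _) hx10)
      (mul_le_mul h3 h4 (Finset.prod_nonneg fun j _ => Nat.cast_nonneg _) (pow_nonneg hy0 _))
      (mul_nonneg (Finset.prod_nonneg fun j _ => Nat.cast_nonneg _)
        (Finset.prod_nonneg fun j _ => Nat.cast_nonneg _)) (mul_nonneg hx10 hx10)
  have hinj : Set.InjOn coord S := by
    intro a _ b _ h
    have h1 : a.1 = b.1 := funext fun j => by
      simpa [hcoord] using congrFun h (Sum.inl (Sum.inl j))
    have h2 : a.2.1 = b.2.1 := funext fun j => by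
      simpa [hcoord] using congrFun h (Sum.inl (Sum.inr j))
    have h3 : a.2.2.1 = b.2.2.1 := funext fun j => by
      simpa [hcoord] using congrFun h (Sum.inr (Sum.inl j))
    have h4 : a.2.2.2 = b.2.2.2 := funext fun j => by
      simpa [hcoord] using congrFun h (Sum.inr (Sum.inr j))
    exact Prod.ext h1 (Prod.ext h2 (Prod.ext h3 h4))
  have hf : ∀ r : ℕ, 0 ≤ 2 * primeCountingAPErrMax X r := fun r =>
    mul_nonneg zero_le_two (primeCountingAPErrMax_nonneg X r)
  have hw : ∀ a ∈ S, |lam c Fd G ε x a.1 a.2.2.1 * lam c Fd G ε x a.2.1 a.2.2.2| ≤ Λ ^ 2 := by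
    intro a _
    rw [abs_mul, sq]
    exact mul_le_mul (hΛ _ _) (hΛ _ _) (abs_nonneg _) hΛ0
  have hmain := sum_mul_rad_le S coord ⌊(x : ℝ) ^ (1 / 5 : ℝ) * y ε x ^ (2 * k)⌋₊ hsq hM hinj hf
    (w := fun a => lam c Fd G ε x a.1 a.2.2.1 * lam c Fd G ε x a.2.1 a.2.2.2) (sq_nonneg Λ) hw
  refine hmain.trans (le_of_eq ?_)
  congr 1
  refine Finset.sum_congr rfl fun r _ => ?_
  congr 2
  simp only [Fintype.card_sum, Fintype.card_fin]
  ring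

/-! ### `x^{1/5} y^{2k} ≤ x^{1/4}` for large `x` -/

/-- For `0 ≤ ε` and all large `x`: `x^{1/5} y^{2k} ≤ x^{1/4}` (`log y ≤ log x · log₃ x/log₂ x` and
`log₃ x/log₂ x → 0`). [cite: Maynard2016LargeGaps, Lemma 7 (proof, «r < x^{1/5+o(1)}»)] -/
theorem eventually_rpow_mul_y_pow_le (k : ℕ) {ε : ℝ} (hε0 : 0 ≤ ε) :
    ∀ᶠ x : ℕ in atTop, (x : ℝ) ^ (1 / 5 : ℝ) * y ε x ^ (2 * k) ≤ (x : ℝ) ^ (1 / 4 : ℝ) := by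
  have hδ : (0 : ℝ) < 1 / (40 * k + 1) := by positivity
  have hT₂ : Tendsto (fun X : ℝ => Real.log (Real.log X)) atTop atTop :=
    Real.tendsto_log_atTop.comp Real.tendsto_log_atTop
  have hreal : ∀ᶠ X : ℝ in atTop,
      ‖Real.log (Real.log (Real.log X))‖ ≤ 1 / (40 * k + 1) * ‖Real.log (Real.log X)‖ :=
    hT₂.eventually (Real.isLittleO_log_id_atTop.bound hδ)
  filter_upwards [tendsto_natCast_atTop_atTop.eventually hreal, eventually_iteratedLogs]
    with x hx hlogs
  obtain ⟨hL, hL₂, hL₃, -, -, -, -⟩ := hlogs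
  have hx0 : (0 : ℝ) < x := by
    have : (1 : ℝ) < x := by
      by_contra h
      push Not at h
      linarith [Real.log_nonpos (Nat.cast_nonneg x) h]
    linarith
  rw [Real.norm_of_nonneg (by linarith), Real.norm_of_nonneg (by linarith)] at hx
  -- `2k log y ≤ log x / 20`
  have hL₂pos : 0 < Real.log (Real.log x) := by linarith
  have hratio : Real.log (Real.log (Real.log (x : ℝ))) / Real.log (Real.log x) ≤
      1 / (40 * k + 1) := by
    rw [div_le_iff₀ hL₂pos]; exact hx
  have hlogy : Real.log (y ε x) ≤
      Real.log x * (Real.log (Real.log (Real.log (x : ℝ))) / Real.log (Real.log x)) := by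
    rw [log_y]
    have h3 : (1 - ε) * (Real.log x * Real.log (Real.log (Real.log (x : ℝ))) /
        Real.log (Real.log x)) = (1 - ε) * (Real.log x *
          (Real.log (Real.log (Real.log (x : ℝ))) / Real.log (Real.log x))) := by ring
    rw [h3]
    have h4 : 0 ≤ Real.log x * (Real.log (Real.log (Real.log (x : ℝ))) / Real.log (Real.log x)) :=
      mul_nonneg (by linarith) (div_nonneg (by linarith) hL₂pos.le)
    nlinarith
  have hk0 : (0 : ℝ) ≤ k := Nat.cast_nonneg k
  have h2k : (2 * k : ℕ) * Real.log (y ε x) ≤ Real.log x / 20 := by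
    push_cast
    have h5 : (2 * k : ℝ) * Real.log (y ε x) ≤ 2 * k * (Real.log x *
        (Real.log (Real.log (Real.log (x : ℝ))) / Real.log (Real.log x))) :=
      mul_le_mul_of_nonneg_left hlogy (by positivity)
    refine h5.trans ?_
    have h6 : 2 * (k : ℝ) * (1 / (40 * k + 1)) ≤ 1 / 20 := by
      rw [mul_one_div, div_le_iff₀ (by positivity)]; nlinarith
    calc 2 * (k : ℝ) * (Real.log x * (Real.log (Real.log (Real.log (x : ℝ))) /
          Real.log (Real.log x)))
        = Real.log x * (2 * k * (Real.log (Real.log (Real.log (x : ℝ))) /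
            Real.log (Real.log x))) := by ring
      _ ≤ Real.log x * (2 * k * (1 / (40 * k + 1))) :=
          mul_le_mul_of_nonneg_left (mul_le_mul_of_nonneg_left hratio (by positivity)) (by linarith)
      _ ≤ Real.log x * (1 / 20) := mul_le_mul_of_nonneg_left h6 (by linarith)
      _ = Real.log x / 20 := by ring
  -- exponentiate
  have hypow : y ε x ^ (2 * k) ≤ (x : ℝ) ^ (1 / 20 : ℝ) := by
    have hy : y ε x ^ (2 * k) = Real.exp ((2 * k : ℕ) * Real.log (y ε x)) := by
      rw [Real.exp_nat_mul, Real.exp_log (show 0 < y ε x from Real.exp_pos _)]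
    rw [hy, Real.rpow_def_of_pos hx0]
    refine Real.exp_le_exp.2 (h2k.trans (le_of_eq ?_))
    ring
  calc (x : ℝ) ^ (1 / 5 : ℝ) * y ε x ^ (2 * k) ≤ (x : ℝ) ^ (1 / 5 : ℝ) * (x : ℝ) ^ (1 / 20 : ℝ) :=
        mul_le_mul_of_nonneg_left hypow (Real.rpow_nonneg hx0.le _)
    _ = (x : ℝ) ^ (1 / 4 : ℝ) := by rw [← Real.rpow_add hx0]; norm_num

/-! ### The error terms are `≪_A x (log x)^{−A}` -/

/-- **Error terms of Lemma 7 ((6.29)–(6.31)).**  For `0 ≤ ε ≤ 1/2` and every `A > 0` there is `C`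
such that for all large `x` and every `i`:
`Σ_{d,d',e,e' ∈ rbox} |λ_{d,e} λ_{d',e'}| · 2E*(x; r_{d,d',e,e'}) ≤ C x/(log x)^A`
(Bombieri–Vinogradov at level `x^{1/4}`, the moduli being `≤ x^{1/5} y^{2k} ≤ x^{1/4}`). [cite: Maynard2016LargeGaps, Lemma 7 (proof, displays (6.29)–(6.31))] -/
theorem exists_eventually_errorSum_le {J : ℕ} {c : Fin J → ℝ} {Fd : Fin k → Fin J → ℝ → ℝ}
    {G : ℝ → ℝ} (hD : IsSieveData k J c Fd G) {ε : ℝ} (hε0 : 0 ≤ ε) (hε : ε ≤ 1 / 2) {A : ℝ}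
    (hA : 0 < A) :
    ∃ C : ℝ, ∀ᶠ x : ℕ in atTop, ∀ i : Fin k,
      ∑ d ∈ rbox k x i, ∑ d' ∈ rbox k x i, ∑ e ∈ rbox k x i, ∑ e' ∈ rbox k x i,
          |lam c Fd G ε x d e * lam c Fd G ε x d' e'| *
            (2 * primeCountingAPErrMax x (radMod d d' e e')) ≤ C * x / Real.log x ^ A := by
  obtain ⟨Λ, hΛ0, hΛ⟩ := exists_abs_lam_le hD
  obtain ⟨C₀, hC₀⟩ := exists_eventually_sum_subset_errMax_le (θ := 1 / 4) (by norm_num)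
    (K := (2 : ℝ) ^ (4 * k)) (by positivity) hA
  refine ⟨Λ ^ 2 * (2 * C₀), ?_⟩
  filter_upwards [hC₀, eventually_iteratedLogs, eventually_rpow_mul_y_pow_le k hε0]
    with x hx hlogs hgrow i
  obtain ⟨hL, hL₂, hL₃, -, hL₂L, -, -⟩ := hlogs
  have hlogx : 0 < Real.log x := by linarith
  have hlogy : 0 < Real.log (y ε x) := log_y_pos hε (by linarith) (by linarith) hL₃
  have h1 := errorSum_le_of_abs_lam_le hD hlogx hlogy i x hΛ0 (fun d e => hΛ ε x d e hlogx hlogy)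
  refine h1.trans ?_
  have hsub : (Finset.Icc 1 ⌊(x : ℝ) ^ (1 / 5 : ℝ) * y ε x ^ (2 * k)⌋₊).filter Squarefree ⊆
      Finset.Icc 1 ⌊(x : ℝ) ^ (1 / 4 : ℝ)⌋₊ :=
    (Finset.filter_subset _ _).trans (Finset.Icc_subset_Icc le_rfl (Nat.floor_mono hgrow))
  have h2 := hx _ hsub
  have h3 : ∑ r ∈ (Finset.Icc 1 ⌊(x : ℝ) ^ (1 / 5 : ℝ) * y ε x ^ (2 * k)⌋₊).filter Squarefree,
      ((2 : ℝ) ^ (4 * k)) ^ ω r * (2 * primeCountingAPErrMax x r) =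
        2 * ∑ r ∈ (Finset.Icc 1 ⌊(x : ℝ) ^ (1 / 5 : ℝ) * y ε x ^ (2 * k)⌋₊).filter Squarefree,
          ((2 : ℝ) ^ (4 * k)) ^ ω r * primeCountingAPErrMax x r := by
    rw [Finset.mul_sum]
    refine Finset.sum_congr rfl fun r _ => ?_
    ring
  rw [h3]
  calc Λ ^ 2 * (2 * ∑ r ∈ (Finset.Icc 1 ⌊(x : ℝ) ^ (1 / 5 : ℝ) * y ε x ^ (2 * k)⌋₊).filter
          Squarefree, ((2 : ℝ) ^ (4 * k)) ^ ω r * primeCountingAPErrMax x r)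
      ≤ Λ ^ 2 * (2 * (C₀ * x / Real.log x ^ A)) :=
        mul_le_mul_of_nonneg_left (mul_le_mul_of_nonneg_left h2 zero_le_two) (sq_nonneg Λ)
    _ = Λ ^ 2 * (2 * C₀) * x / Real.log x ^ A := by ring

end Maynard2016

end Literature.NumberTheory.Sieve

end
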